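import Summits.Langlands.Langlands.Theses.SkinnerWilesDefectOne
import Summits.Langlands.Langlands.Theorems.BianchiCongruenceCohomologyFinite.Negative.FalseWithoutFinite
import Summits.Langlands.Langlands.Theorems.BianchiCongruenceCohomologyFinite.Negative.FalseWithoutCompact
import Summits.Langlands.Langlands.Theorems.BianchiCongruenceCohomologyFinite.Negative.TorsionAllDegrees
import Literature.NumberTheory.Automorphic.ArithmeticQuotientCohomologyFiniteProofs

/-!
# Disproof of `BianchiCongruenceCohomologyFinite` (stmt-Langlands-15362) — findings

Crux (route `SkinnerWilesDefectOne`, rank 7; the `n = 2`, imaginary-quadratic instance of the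
Literature named fact `BorelSerre1973_finite_groupCohomology_congruenceSubgroup`):

  `∀ K (number field, finrank ℚ K = 2, totally complex) (U ≤ GL₂(𝔸_K^∞) open, compact)
     (A : Rep ℤ Γ_U, Γ_U = GL₂(K) ∩ U = U.comap (globalEmbedding 2 K)), Finite A →
     ∀ q, Finite (groupCohomology A q)`.

**VERDICT (cdisprove cycle 1, 2026-08-16): NO KILL — the crux is a theorem in print** (arithmetic
groups are of type (WFL), Borel–Serre 1973 Thm. 11.4.4 / Serre 1971 §2.4 Th. 4 (a); (WFL) ⇒ (VFL)
⇒ FP_∞ over `ℤ`, Brown VIII (5.1); FP_∞ + finite coefficients ⇒ `Hom(P_q, A)` finite ⇒ `H^q`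
finite) and is junk-free as typed (read-back: units topology over Mathlib's restricted-product
`FiniteAdeleRing`, `Finite A ↔ Finite A.V` by `Iff.rfl`, `Γ_U` commensurable with `GL₂(𝓞_K)` by the
in-tree `BigHeckeGLn.commensurable_comap_globalEmbedding_glIntegers`).  What this file records,
ALL KERNEL-CHECKED (no `sorry`) and, where marked LANDED, accepted under
`Theorems/BianchiCongruenceCohomologyFinite/Negative/`:

(a) LOAD-BEARING HYPOTHESES
  * `Finite A` — load-bearing: `bianchiCongruenceCohomologyFinite_false_without_finite`
    (LANDED p112242 by the batch refuter; `A = ℤ`, `q = 0`).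
  * `IsCompact U` — load-bearing: `bianchiCongruenceCohomologyFinite_false_without_isCompact`
    (LANDED p116189; `U = ⊤`, `Γ_U = GL₂(K)`, `H¹(GL₂(K), ℤ/3) = Hom(GL₂(K), ℤ/3)` infinite through
    the characters `v_p(N_{K/ℚ} det) mod 3`, `p` prime — `GL₂(K)` is not finitely generated).
  * `IsOpen U` — NOT refuted and believed NOT load-bearing for TRUTH at `n = 2` (see
    `BianchiCongruenceCohomologyFiniteWithoutIsOpen`): for `U` merely compact, `Γ_U` is a
    congruence-closed subgroup of an arithmetic group; by strong approximation for Zariski-dense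
    subgroups (Nori–Weisfeiler / Matthews–Vaserstein–Weisfeiler / Pink) and the virtual solvability
    of proper algebraic subgroups of `SL₂`, such a `Γ_U` is virtually arithmetic (Bianchi-type,
    `SL₂(ℤ)`-type, or units of a quaternion `ℚ`-order split by `K`) or finitely generated virtually
    abelian — FP_∞ in every case.  Deep and off-route; no Lean attempt.  It IS load-bearing for the
    METHOD: without openness `Γ_U` need not be commensurable with `GL₂(𝓞_K)`
    (`not_commensurable_comap_bot_glIntegers`: `U = ⊥` gives `Γ_U = 1`; also `U = GL₂(ẑ)` gives
    `Γ_U = GL₂(ℤ)`, of infinite index), so the in-tree reduction chain is unavailable.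
  * `finrank ℚ K = 2`, `IsTotallyComplex K` — NOT load-bearing for truth (Borel–Serre holds for
    every number field; `BianchiCongruenceCohomologyFiniteAllFields` = the Literature fact at
    `n = 2` implies the crux, `bianchiCongruenceCohomologyFinite_of_allFields`); they are SCOPE
    hypotheses that make a cheap proof possible (`ℍ³`, `ℚ`-rank 1, 2-dimensional spine, finite
    unit group `𝓞_K^× `).
(b) DEGENERATE / TIGHT CASES
  * `q = 0` is free for every group (`bianchiCongruenceCohomologyFinite_degree_zero`, LANDED): the
    content starts at `q = 1` (finite generation of `Γ_U`) and is genuinely "every `q`" (FP_∞).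
  * `A = 0`, `Γ_U` finite: trivial / impossible (`U` open ⇒ `Γ_U ⊇ Γ(𝔫)` infinite).
(c) NATURAL STRENGTHENINGS — REFUTED (LANDED p116550, `Negative/TorsionAllDegrees.lean`)
  * "vanishing above `vcd = 2`": `not_bianchiCongruenceCohomology_subsingleton_above_two`;
  * "eventually zero" / finite `cd`: `not_bianchiCongruenceCohomology_eventually_subsingleton`;
    both from `nontrivial_groupCohomology_glIntegers_cyclotomicField_three :
    ∀ q, H^q(GL₂(𝓞_{ℚ(ζ₃)}), ℤ/2) ≠ 0` (the retract `C₂ = ⟨diag(-1,1)⟩`, retraction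
    `det mod (ζ₃ - 1) ∈ 𝔽₃ˣ = {±1}`; Mathlib's finite-cyclic cohomology);
  * "finitely generated coefficients, finite conclusion": `not_bianchiCongruenceCohomology_moduleFinite_coefficients`
    (`A = ℤ`, `q = 0`; the TRUE f.g. version concludes `Module.Finite ℤ (H^q)`, Brown VIII (5.1)).
  CONSEQUENCE FOR PROVERS: `Γ_U` with 2-torsion is not of type (FL) and has no finite-length
  projective resolution; finite-type resolutions exist only for TORSION-FREE finite-index
  subgroups (`Γ(𝔫)`, `N𝔫 ≥ 3`), and the crux must be reached by finite-index ASCENT (in-tree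
  `Literature.Algebra.Homology.finite_groupCohomology_of_finiteIndex`) — exactly the shape of
  `BorelSerre1973_finite_groupCohomology_congruenceSubgroup_of_typeFL_torsionFree`.  Do not state
  "`H^q = 0` for `q ≥ 3`" or "`cd Γ_U = 2`" as an intermediate lemma.
(d) TARGETS (lead's stuck stubs): none yet — no line picked at this cycle.
(e) NEAR-MISSES: none carried with `sorry`.

Barriers catalogue (`Literature/Barriers/Langlands/`): nothing applies (the crux is pure
arithmetic-group cohomology; no automorphy-lifting / patching content).  Negatives index: no
prior refutation touches Bianchi cohomology.
-/

set_option linter.dupNamespace false -- project-wide option; `Summit.Langlands.Langlands` is the mandated namespace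

noncomputable section

open CategoryTheory NumberField
open Literature.NumberTheory.Automorphic
open Summit.Langlands.Langlands.Theses.SkinnerWilesDefectOne
open Summit.Langlands.Langlands.Theorems.BianchiCongruenceCohomologyFinite

namespace Summit.Langlands.Langlands.Cruxes.BianchiCongruenceCohomologyFinite.Disproof

/-! ## (a) Load-bearing analysis -/

/-- The crux with `Finite A` DROPPED. FALSE (`bianchiCongruenceCohomologyFinite_false_without_finite`). -/
def BianchiCongruenceCohomologyFiniteWithoutFinite : Prop :=
  ∀ (K : Type) [Field K] [NumberField K], Module.finrank ℚ K = 2 → IsTotallyComplex K →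
    ∀ (U : Subgroup (BigHeckeGLn.FiniteAdelicGL 2 K)),
      IsOpen (U : Set (BigHeckeGLn.FiniteAdelicGL 2 K)) →
      IsCompact (U : Set (BigHeckeGLn.FiniteAdelicGL 2 K)) →
      ∀ (A : Rep ℤ (U.comap (BigHeckeGLn.globalEmbedding 2 K))) (q : ℕ),
        Finite (groupCohomology A q)

/-- **Any proof must use `Finite A`** (`A = ℤ`, `q = 0`, `H⁰ = ℤ`; LANDED p112242). [folklore] -/
theorem bianchiCongruenceCohomologyFinite_false_without_finite :
    ¬ BianchiCongruenceCohomologyFiniteWithoutFinite :=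
  Negative.bianchiCongruenceCohomologyFinite_false_without_finite

/-- The crux with `IsCompact U` DROPPED. FALSE
(`bianchiCongruenceCohomologyFinite_false_without_isCompact`). -/
def BianchiCongruenceCohomologyFiniteWithoutIsCompact : Prop :=
  ∀ (K : Type) [Field K] [NumberField K], Module.finrank ℚ K = 2 → IsTotallyComplex K →
    ∀ (U : Subgroup (BigHeckeGLn.FiniteAdelicGL 2 K)),
      IsOpen (U : Set (BigHeckeGLn.FiniteAdelicGL 2 K)) →
      ∀ (A : Rep ℤ (U.comap (BigHeckeGLn.globalEmbedding 2 K))), Finite A →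
        ∀ q : ℕ, Finite (groupCohomology A q)

/-- **Any proof must use `IsCompact U`** (`U = ⊤`, `Γ_U = GL₂(K)`, `A = ℤ/3`, `q = 1`:
`H¹(GL₂(K), ℤ/3)` is infinite, `Negative.not_finite_H1_trivial_zmod_three`; LANDED p116189).
[folklore] -/
theorem bianchiCongruenceCohomologyFinite_false_without_isCompact :
    ¬ BianchiCongruenceCohomologyFiniteWithoutIsCompact :=
  Negative.bianchiCongruenceCohomologyFinite_false_without_isCompact

/-- The crux with `IsOpen U` DROPPED.  STATUS: OPEN HERE, believed TRUE at `n = 2` (hence no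
`_false_without_isOpen`): a compact `U` lies in a compact open `U₀ = Stab(∑_{u ∈ U/U∩GL₂(𝒪̂)} u𝒪̂²)`,
so `Γ_U = Γ_{U₀} ∩ U` is a subgroup of the arithmetic group `Γ_{U₀}` closed in the congruence
topology; solvable pieces meet `U` in finitely generated groups (unit entries forced into `𝓞_K^×`,
off-diagonal entries into a fractional ideal), and a Zariski-dense piece has open closure in the
adelic points of its minimal `ℚ`-form (strong approximation for Zariski-dense subgroups:
Nori, Weisfeiler, Matthews–Vaserstein–Weisfeiler, Pink), making `Γ_U` virtually arithmetic in a
`ℚ`-form of `SL₂` (Bianchi, `SL₂(ℤ)`, or a quaternion order) — FP_∞ in all cases.  Too deep to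
land; recorded so that no seat spends time on `U = ⊥` (harmless: `Γ_⊥ = 1`) or `U = GL₂(ẑ)`
(`Γ_U = GL₂(ℤ)`, virtually free: finite cohomology).  It IS load-bearing for the in-tree METHOD,
see `not_commensurable_comap_bot_glIntegers`. -/
def BianchiCongruenceCohomologyFiniteWithoutIsOpen : Prop :=
  ∀ (K : Type) [Field K] [NumberField K], Module.finrank ℚ K = 2 → IsTotallyComplex K →
    ∀ (U : Subgroup (BigHeckeGLn.FiniteAdelicGL 2 K)),
      IsCompact (U : Set (BigHeckeGLn.FiniteAdelicGL 2 K)) →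
      ∀ (A : Rep ℤ (U.comap (BigHeckeGLn.globalEmbedding 2 K))), Finite A →
        ∀ q : ℕ, Finite (groupCohomology A q)

/-- `K → 𝔸_K^∞` is injective (evaluate at any finite place `v`, which exists since `𝓞 K` is not a
field; `K → K_v` is a field homomorphism). [folklore] -/
theorem algebraMap_finiteAdeleRing_injective (K : Type) [Field K] [NumberField K] :
    Function.Injective (algebraMap K (IsDedekindDomain.FiniteAdeleRing (𝓞 K) K)) := by
  obtain ⟨M, hM⟩ := Ideal.exists_maximal (𝓞 K)
  have hne : M ≠ ⊥ := Ring.ne_bot_of_isMaximal_of_not_isField hM (RingOfIntegers.not_isField K)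
  let v : IsDedekindDomain.HeightOneSpectrum (𝓞 K) := ⟨M, hM.isPrime, hne⟩
  intro a b h
  have h' := congrArg (fun x : IsDedekindDomain.FiniteAdeleRing (𝓞 K) K => x v) h
  simp only [IsDedekindDomain.FiniteAdeleRing.algebraMap_apply] at h'
  exact (algebraMap K (v.adicCompletion K)).injective h'

/-- The diagonal embedding `GL₂(K) → GL₂(𝔸_K^∞)` is injective. [folklore] -/
theorem globalEmbedding_injective (K : Type) [Field K] [NumberField K] :
    Function.Injective (BigHeckeGLn.globalEmbedding 2 K) := fun g g' h =>
  Matrix.GeneralLinearGroup.ext fun i j => algebraMap_finiteAdeleRing_injective K <| by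
    simpa only [BigHeckeGLn.globalEmbedding, Matrix.GeneralLinearGroup.map_apply] using
      congrArg (fun x : BigHeckeGLn.FiniteAdelicGL 2 K =>
        (x : Matrix (Fin 2) (Fin 2) (IsDedekindDomain.FiniteAdeleRing (𝓞 K) K)) i j) h

/-- **`IsOpen U` is load-bearing for the METHOD** (the in-tree reduction starts from
`BigHeckeGLn.commensurable_comap_globalEmbedding_glIntegers`, which needs `U` open): for the
compact, non-open level `U = ⊥` the congruence subgroup `Γ_⊥ = ker(globalEmbedding) = 1` is NOT
commensurable with (the image of) `GL₂(𝓞_K)`, which is infinite (`upperRightHom` embeds `𝓞_K`).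
[folklore] -/
theorem not_commensurable_comap_bot_glIntegers (K : Type) [Field K] [NumberField K] :
    ¬ ((⊥ : Subgroup (BigHeckeGLn.FiniteAdelicGL 2 K)).comap
        (BigHeckeGLn.globalEmbedding 2 K)).Commensurable
      (Matrix.GeneralLinearGroup.map (algebraMap (𝓞 K) K) :
        GL (Fin 2) (𝓞 K) →* GL (Fin 2) K).range := by
  rw [MonoidHom.comap_bot, (MonoidHom.ker_eq_bot_iff _).2 (globalEmbedding_injective K)]
  rintro ⟨h, -⟩
  rw [Subgroup.relIndex_bot_left] at h
  refine h (@Nat.card_eq_zero_of_infinite _ ?_)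
  haveI : Infinite (GL (Fin 2) (𝓞 K)) :=
    Infinite.of_injective _ Matrix.GeneralLinearGroup.injective_upperRightHom
  exact Infinite.of_injective _ (MonoidHom.ofInjective
    (BigHeckeGLn.map_algebraMap_ringOfIntegers_injective 2 K)).injective

/-- The crux with the field hypotheses (`finrank ℚ K = 2`, `IsTotallyComplex K`) DROPPED = the
Literature named fact `BorelSerre1973_finite_groupCohomology_congruenceSubgroup` at `n = 2`, every
number field.  TRUE in print (Borel–Serre for `R_{K/ℚ} GL₂`, any `K`), so the field hypotheses are
not load-bearing for truth — they only make the cheap proof (`ℍ³`, 2-dimensional spine, finite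
`𝓞_K^×`) available. -/
def BianchiCongruenceCohomologyFiniteAllFields : Prop :=
  ∀ (K : Type) [Field K] [NumberField K] (U : Subgroup (BigHeckeGLn.FiniteAdelicGL 2 K)),
    IsOpen (U : Set (BigHeckeGLn.FiniteAdelicGL 2 K)) →
    IsCompact (U : Set (BigHeckeGLn.FiniteAdelicGL 2 K)) →
    ∀ (A : Rep ℤ (U.comap (BigHeckeGLn.globalEmbedding 2 K))), Finite A →
      ∀ q : ℕ, Finite (groupCohomology A q)

/-- The all-fields version implies the crux (specialisation). [folklore] -/
theorem bianchiCongruenceCohomologyFinite_of_allFields (h : BianchiCongruenceCohomologyFiniteAllFields) :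
    BianchiCongruenceCohomologyFinite :=
  fun K _ _ _ _ U hUo hUc A hA q => h K U hUo hUc A hA q

/-- The Literature named fact (all `n`, all `K`) implies the all-fields version, hence the crux
(the planner's rewiring certificate, restated). [folklore] -/
theorem allFields_of_borelSerre (h : BorelSerre1973_finite_groupCohomology_congruenceSubgroup) :
    BianchiCongruenceCohomologyFiniteAllFields :=
  fun K _ _ U hUo hUc A hA q => h 2 K U hUo hUc A hA q

/-! ## (b) Degenerate / tight cases -/

/-- Degree `0` is free (any group, any finite `A`; LANDED). [folklore] -/
theorem bianchiCongruenceCohomologyFinite_degree_zero (K : Type) [Field K] [NumberField K]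
    (U : Subgroup (BigHeckeGLn.FiniteAdelicGL 2 K))
    (A : Rep ℤ (U.comap (BigHeckeGLn.globalEmbedding 2 K))) (hA : Finite A) :
    Finite (groupCohomology A 0) :=
  Negative.bianchiCongruenceCohomologyFinite_degree_zero K U A hA

/-! ## (c) Refuted strengthenings -/

/-- **No vanishing above `vcd = 2`** (LANDED p116550). [folklore] -/
theorem not_subsingleton_above_two :
    ¬ ∀ (K : Type) [Field K] [NumberField K], Module.finrank ℚ K = 2 → IsTotallyComplex K →
        ∀ (U : Subgroup (BigHeckeGLn.FiniteAdelicGL 2 K)),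
          IsOpen (U : Set (BigHeckeGLn.FiniteAdelicGL 2 K)) →
          IsCompact (U : Set (BigHeckeGLn.FiniteAdelicGL 2 K)) →
          ∀ (A : Rep ℤ (U.comap (BigHeckeGLn.globalEmbedding 2 K))), Finite A →
            ∀ q : ℕ, 2 < q → Subsingleton (groupCohomology A q) :=
  Negative.not_bianchiCongruenceCohomology_subsingleton_above_two

/-- **No eventual vanishing — `Γ_U` has `2`-torsion classes in every degree** (LANDED p116550).
[folklore] -/
theorem not_eventually_subsingleton :
    ¬ ∀ (K : Type) [Field K] [NumberField K], Module.finrank ℚ K = 2 → IsTotallyComplex K →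
        ∀ (U : Subgroup (BigHeckeGLn.FiniteAdelicGL 2 K)),
          IsOpen (U : Set (BigHeckeGLn.FiniteAdelicGL 2 K)) →
          IsCompact (U : Set (BigHeckeGLn.FiniteAdelicGL 2 K)) →
          ∀ (A : Rep ℤ (U.comap (BigHeckeGLn.globalEmbedding 2 K))), Finite A →
            ∃ q₀ : ℕ, ∀ q : ℕ, q₀ ≤ q → Subsingleton (groupCohomology A q) :=
  Negative.not_bianchiCongruenceCohomology_eventually_subsingleton

/-- `H^q(GL₂(𝓞_{ℚ(ζ₃)}), ℤ/2) ≠ 0` for EVERY `q` (LANDED p116550): the all-degrees torsion that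
kills both strengthenings above. [folklore] -/
theorem torsion_all_degrees (q : ℕ) :
    Nontrivial (groupCohomology (Rep.trivial ℤ
      ((glFiniteIntegralLevel 2 (CyclotomicField 3 ℚ)).comap
        (BigHeckeGLn.globalEmbedding 2 (CyclotomicField 3 ℚ))) (ZMod 2)) q) :=
  Negative.nontrivial_groupCohomology_glIntegers_cyclotomicField_three q

/-- **Finitely generated coefficients do not give FINITE cohomology** (only finitely generated
cohomology, Brown VIII (5.1)): the strengthening of the crux weakening `Finite A` to
`Module.Finite ℤ A` is FALSE (`A = ℤ`, `q = 0`, at `K = ℚ(ζ₃)`, `U = GL₂(𝒪̂_K)`). [folklore] -/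
theorem not_bianchiCongruenceCohomology_moduleFinite_coefficients :
    ¬ ∀ (K : Type) [Field K] [NumberField K], Module.finrank ℚ K = 2 → IsTotallyComplex K →
        ∀ (U : Subgroup (BigHeckeGLn.FiniteAdelicGL 2 K)),
          IsOpen (U : Set (BigHeckeGLn.FiniteAdelicGL 2 K)) →
          IsCompact (U : Set (BigHeckeGLn.FiniteAdelicGL 2 K)) →
          ∀ (A : Rep ℤ (U.comap (BigHeckeGLn.globalEmbedding 2 K))), Module.Finite ℤ A →
            ∀ q : ℕ, Finite (groupCohomology A q) := fun h =>
  Negative.not_finite_groupCohomology_zero_trivial_int _ (h (CyclotomicField 3 ℚ)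
    Negative.finrank_cyclotomicField_three Negative.isTotallyComplex_cyclotomicField_three
    (glFiniteIntegralLevel 2 _) (isOpen_glFiniteIntegralLevel 2 _)
    (isCompact_glFiniteIntegralLevel_holds 2 _) (Rep.trivial ℤ _ ℤ)
    (inferInstanceAs (Module.Finite ℤ ℤ)) 0)

/-! ## (d) Targets (lead's stuck stubs) — Line `horoball-cech-coresolution` (PICKED: `SketchIdeator2.lean`,
reshaped by the lead to Γ-translates of finitely many archimedean Siegel sets; no registered skeleton /
stuck stub on this seat's payload yet)

No formal target at cycle 1.  PAPER TRIAGE of the nine sorried first lemmas of `SketchIdeator2.lean`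
(all found TRUE as typed — nothing to kill; recorded so that no later seat repeats it):
* (L1) `finite_groupCohomology_of_equivariant_convex_cover` — true: the ORDERED Čech complex of ALL
  functions on the (possibly infinite) nerve with values in `A` is exact in positive degrees for a
  cover of the contractible `Ω` by convex opens (nerve theorem, paracompact `Ω`); `Fun(orbit of J, A)`
  is the COINDUCED module `Coind_{G_J}^G A` (a product, so Shapiro holds with infinite orbits);
  finitely many orbits + `hstab` + dimension shifting (in-tree engine) give the claim.  `φ` into the
  monoid `E →L[ℝ] E` is harmless (images of a group are invertible).  No hypothesis is vacuous.
* (L2) reduction to `GL₂(𝓞_K)` — true (in-tree chain at `n = 2`).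
* (L3) `convex_posCone` — true; `convex_horoballCone v t` — true for ALL `v, t` (for `t ≤ 0`, or
  `v = 0` with `t ≤ 0`, the set is empty; for `t > 0` use concavity of `√det` on positive binary
  Hermitian forms = Minkowski's determinant inequality at `n = 2`); `image_horoballCone` — true
  (`(gv)^*(g⁻¹)^*hg⁻¹(gv) = v^*hv`, `det((g⁻¹)ᴴhg⁻¹) = |det g|⁻² det h`).
* (L4) `exists_hermite_const` — true (Minkowski in `ℂ² ≅ ℝ⁴`: the real form of `h` has determinant
  `(det h)²`, so the ellipsoid `{x^*hx < r}` has volume `≍ r²/det h`; `t² ≍ covol(𝓞_K²)`);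
  `normSq_det_mul_det_le` — true (Gram determinant: `|det(v,w)|² det h = h(v)h(w) − |h(v,w)|²`);
  `finite_fixing_two_lines` — true (eigenvalues `a, b ∈ K` of an integral invertible matrix are in
  `𝓞_K^×`, finite for `K` imaginary quadratic; `g` is determined by `(a, b)`);
  `finite_groupCohomology_intLatticeTwo` — true (`ℤ²` is of type (FL), Koszul).
Consistency with (c): the line never asserts vanishing in high degree and reaches `Γ_U` with torsion
only through finite simplex stabilisers / Shapiro — compatible with `torsion_all_degrees`.

## (e) Near-misses

None carried with `sorry`.  The only open question of this file is the truth of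
`BianchiCongruenceCohomologyFiniteWithoutIsOpen` (believed true; see its docstring). -/

end Summit.Langlands.Langlands.Cruxes.BianchiCongruenceCohomologyFinite.Disproof

end
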